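import Mathlib.Analysis.Convex.Join
import Mathlib.Analysis.Calculus.Deriv.MeanValue
import Mathlib.Analysis.Calculus.ContDiff.Deriv
import Mathlib.Analysis.SpecialFunctions.Integrals.Basic
import Mathlib.MeasureTheory.Measure.Lebesgue.EqHaar
import Mathlib.MeasureTheory.Measure.Haar.InnerProductSpace
import Mathlib.LinearAlgebra.Matrix.Determinant.Basic
import Literature.MathematicalPhysics.StatisticalMechanics.Theil2006
import HarnessLib

/-!
# Theil 2006, Lemma 2.10: the energy of one equilateral simplex to second order (Heron + Taylor)

Topic: `Literature/MathematicalPhysics/StatisticalMechanics`; companion to `Theil2006.lean`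
(F. Theil, *A proof of crystallization in two dimensions*, Comm. Math. Phys. **262** (2006)
209–236; read in the author's accepted preprint of 26 Aug 2005, identical numbering, p. 10).
Everything here is PROVED; no named fact is added or discharged. Lemma 2.10 is the triangle-level
inequality of §2.4 ("Resummation") from which the long-range estimates (31)–(33) and finally the
main estimate (9) of the lower bound of Theorem 1.1 (`Theil2006_groundStateEnergy`) are assembled;
the estimate concerns one simplex `Y` of the reference configuration at a time.

## The printed statement (preprint p. 10, verbatim)

> **Lemma 2.10.** There exists two constants `C, α₀ > 0` such that for all `α ∈ (0, α₀)`,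
> `f ∈ C²([0, ∞))`, `λ ∈ (0, ∞)` and all `Y = {y₀, y₁, y₂} ⊂ ℝ²` with the property,
> `|(1/λ)|yᵢ - yⱼ| - 1| ≤ α` for `i ≠ j`, the inequality
> (30) `|(2√3/λ) f'(λ) (meas(conv(Y)) - (√3/4) λ²) + 3 f(λ) - ½ Σ_{i≠j} f(|yᵢ - yⱼ|)|`
> `≤ C ((1/λ)|f'(λ)| + ‖f''‖_{L^∞((1-α)λ,(1+α)λ)}) Σ_{i≠j} (|yᵢ - yⱼ| - λ)²`
> holds.
> *Proof.* Let `i ≠ j` and set `δᵢⱼ = (1/λ)|yᵢ - yⱼ| - 1`. Heron's formula, which gives the area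
> of a triangle in terms of it side lengths, yields
> `meas(conv(Y)) = (√3/4) λ² (1 + ⅔ Σ_{i≠j} δᵢⱼ + O(Σ_{i≠j} δᵢⱼ²))^½`
> `= (√3/4) λ² + (1/(4√3)) λ² Σ_{i≠j} δᵢⱼ + O(λ² Σ_{i≠j} δᵢⱼ²)`,
> where the `O`-constant is bounded by a universal number as long as `α ∈ (0, 1)`. By Taylor's
> theorem `|f(|yᵢ - yⱼ|) - f(λ) - λ f'(λ) δᵢⱼ| ≤ (λ²/2) ‖f''‖_{L^∞((1-α)λ,∞)} δᵢⱼ²`. Plugging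
> these two estimates into the left hand side of (30) yields the claim. ∎

## Content (the printed proof, step by step)

* `Theil2006.triangleArea p q r = ½ |det(q - p, r - p)|` and
  **`Theil2006.volume_convexHull_triple`**: `meas(conv{p, q, r}) = triangleArea p q r` for the
  Lebesgue measure of `ℝ² = EuclideanSpace ℝ (Fin 2)` (the triangle is the translate by `p` of the
  linear image `L(Δ₂)` of the standard triangle `Δ₂ = {t : tᵢ ≥ 0, t₀ + t₁ ≤ 1}`,
  `convexHull_triple_eq_image`; `μ(L(Δ₂)) = |det L| μ(Δ₂)` (`Measure.addHaar_image_linearMap`) and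
  `μ(Δ₂) = ½` by Fubini, `volume_paramTriangle`).
* `Theil2006.sixteen_mul_triangleArea_sq` — **Heron's formula** in polynomial form,
  `16 area² = 2a²b² + 2b²c² + 2c²a² - a⁴ - b⁴ - c⁴`.
* `Theil2006.heron_expansion_bound` and **`Theil2006.abs_triangleArea_sub_le`** — Heron to second
  order about the equilateral triangle of side `λ`: if the three sides are within `λ/4` of `λ`,
  `|area - (√3/4) λ² - (√3/6) λ Σ_{pairs} (|yᵢ - yⱼ| - λ)| ≤ 10 Σ_{pairs} (|yᵢ - yⱼ| - λ)²`
  (the printed linear coefficient: `(1/(4√3)) λ² Σ_{i≠j} δᵢⱼ = (√3/6) λ Σ_{pairs} (|yᵢ - yⱼ| - λ)`).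
  The square root is avoided: `area - B = (area² - B²)/(area + B)` with `area² = Heron/16`,
  `B ≥ (√3/8) λ²`, and `|Heron/16 - B²| ≤ 2 λ² Σ εᵢ²` is a polynomial estimate in
  `εᵢ = |yᵢ - yⱼ| - λ` whose constant and linear terms cancel.
* **`Theil2006.abs_sub_sub_deriv_mul_le`** — the Taylor step:
  `|f(x) - f(c) - f'(c)(x - c)| ≤ M (x - c)²` for `c, x ∈ [lo, hi]`, `|f''| ≤ M` on `(lo, hi)`,
  `f ∈ C²` on an open half-line containing `[lo, hi]` (mean value theorem twice).
* **`Theil2006.simplex_expansion_bound`** — (30) for one triangle `p q r` with explicit constants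
  (`40 (|f'(λ)|/λ + M) Σ_{pairs}`, `α ≤ ¼`), for `f ∈ C²` on any open half-line `(a, ∞)` with
  `a < (1-α)λ` (the form needed in (31), where `f = V ∈ C²(1-α, ∞)` and `λ ≥ √3`); the linear
  terms cancel because `(2√3/λ) · (√3/6) λ = 1`.
* **`Theil2006.exists_simplex_expansion_bound`** — Lemma 2.10 AS PRINTED (`∃ C α₀`, `f ∈ C²([0,∞))`,
  `Y = {y 0, y 1, y 2}`, `Σ_{i≠j}` over ordered pairs, `meas(conv(Y)) = volume (convexHull ℝ Y)`),
  with witnesses `C = 20`, `α₀ = ¼` (`simplex_expansion_bound_explicit`), and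
  **`Theil2006.exists_simplex_expansion_bound_sSup`** — the same with the factor
  `‖f''‖_{L^∞((1-α)λ,(1+α)λ)}` written as the supremum of `|f''|` over that interval.

## Rendering and wording risks

* `‖f''‖_{L^∞((1-α)λ,(1+α)λ)}`: in `exists_simplex_expansion_bound` this factor is an arbitrary
  bound `M` of `|f''|` on the open interval `((1-α)λ, (1+α)λ)` (the inequality is monotone in the
  factor, and for the continuous `f''` every value on the interval is below the essential
  supremum, so the printed inequality is the instance `M = ‖f''‖_∞`); in
  `exists_simplex_expansion_bound_sSup` it is `sSup (|f''| '' Ioo ((1-α)λ) ((1+α)λ))`, the supremum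
  (equal to the essential supremum for the continuous `f''`, finite by compactness of the closure
  `⊂ (0, ∞)`). `f'`, `f''` are `deriv f`, `deriv^[2] f` (genuine derivatives: all points involved
  are `> 0`, in the interior of the domain `[0, ∞)`).
* `meas(conv(Y))` is rendered literally as the Lebesgue measure of the convex hull of the three
  points; `|(1/λ)|yᵢ - yⱼ| - 1|` as `|dist (y i) (y j) / lam - 1|`. The printed hypothesis forces
  the three points to be distinct (`α < α₀ ≤ 1`), so `Y` has three elements, as the indexing
  presumes.
* Constants: the paper's `C, α₀` are unspecified ("we do not make any effort to optimize the
  constants", p. 4); ours (`C = 20`, `α₀ = ¼`; `10 ≥ 16/√3` in the Heron step, `1` for `½` in the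
  Taylor step) are explicit but immaterial.
-/

noncomputable section

open scoped BigOperators Topology ENNReal
open Filter Set MeasureTheory

namespace Literature.MathematicalPhysics.StatisticalMechanics

namespace Theil2006

/-! ## The area of a triangle in `ℝ²` -/

/-- The determinant `det(u, v) = u₀ v₁ - u₁ v₀` of two plane vectors. [folklore] -/
def det₂ (u v : Plane) : ℝ := u 0 * v 1 - u 1 * v 0

/-- The area `½ |det(q - p, r - p)|` of the (possibly degenerate) triangle `p q r`; equal to
`meas(conv{p, q, r})` (`volume_convexHull_triple`). [folklore] -/
def triangleArea (p q r : Plane) : ℝ := |det₂ (q - p) (r - p)| / 2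

/-- Areas are nonnegative. [folklore] -/
private theorem triangleArea_nonneg (p q r : Plane) : 0 ≤ triangleArea p q r := by
  unfold triangleArea; positivity

/-- The closed standard parameter triangle `Δ₂ = {t : 0 ≤ t₀, 0 ≤ t₁, t₀ + t₁ ≤ 1}` (in `ℝ²`
coordinates). [folklore] -/
def paramTriangle : Set Plane := {t | 0 ≤ t 0 ∧ 0 ≤ t 1 ∧ t 0 + t 1 ≤ 1}

/-- The linear map `t ↦ t₀ u + t₁ v` of `ℝ²` sending the standard basis to `u, v`. [folklore] -/
def edgeMap₂ (u v : Plane) : Plane →ₗ[ℝ] Plane :=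
  (EuclideanSpace.proj (0 : Fin 2) : Plane →L[ℝ] ℝ).toLinearMap.smulRight u +
    (EuclideanSpace.proj (1 : Fin 2) : Plane →L[ℝ] ℝ).toLinearMap.smulRight v

/-- `L_{u,v} t = t₀ u + t₁ v`. [folklore] -/
@[simp] private theorem edgeMap₂_apply (u v t : Plane) : edgeMap₂ u v t = t 0 • u + t 1 • v := by
  simp [edgeMap₂]

/-- **The triangle as an affine image of `Δ₂`**:
`conv{p, q, r} = {p + t₀ (q - p) + t₁ (r - p) : t ∈ Δ₂}`. [folklore] -/
private theorem convexHull_triple_eq_image (p q r : Plane) :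
    convexHull ℝ ({p, q, r} : Set Plane) =
      (fun t => p + edgeMap₂ (q - p) (r - p) t) '' paramTriangle := by
  rw [convexHull_insert (insert_nonempty q {r}), convexHull_pair, convexJoin_singleton_left]
  ext z
  simp only [mem_iUnion, exists_prop, mem_image]
  constructor
  · rintro ⟨w, hw, hz⟩
    rw [segment_eq_image] at hw hz
    obtain ⟨θ, ⟨hθ0, hθ1⟩, rfl⟩ := hw
    obtain ⟨s, ⟨hs0, hs1⟩, rfl⟩ := hz
    refine ⟨!₂[s * (1 - θ), s * θ], ⟨?_, ?_, ?_⟩, ?_⟩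
    · simpa using mul_nonneg hs0 (sub_nonneg.2 hθ1)
    · simpa using mul_nonneg hs0 hθ0
    · have : s * (1 - θ) + s * θ = s := by ring
      simpa [this] using hs1
    · ext i
      simp
      ring
  · rintro ⟨t, ⟨h0, h1, h2⟩, rfl⟩
    by_cases hst : t 0 + t 1 = 0
    · have ht0 : t 0 = 0 := by linarith
      have ht1 : t 1 = 0 := by linarith
      refine ⟨q, left_mem_segment ℝ q r, ?_⟩
      have : p + edgeMap₂ (q - p) (r - p) t = p := by
        simp [ht0, ht1]
      rw [this]
      exact left_mem_segment ℝ p q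
    · have hs : 0 < t 0 + t 1 := lt_of_le_of_ne (by positivity) (Ne.symm hst)
      refine ⟨(t 0 / (t 0 + t 1)) • q + (t 1 / (t 0 + t 1)) • r, ?_, ?_⟩
      · exact ⟨t 0 / (t 0 + t 1), t 1 / (t 0 + t 1), by positivity, by positivity,
          by field_simp, rfl⟩
      · rw [segment_eq_image]
        refine ⟨t 0 + t 1, ⟨hs.le, h2⟩, ?_⟩
        ext i
        simp
        field_simp
        ring

/-- `det L_{u,v} = det(u, v)`. [folklore] -/
private theorem det_edgeMap₂ (u v : Plane) : LinearMap.det (edgeMap₂ u v) = det₂ u v := by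
  rw [← LinearMap.det_toMatrix (EuclideanSpace.basisFun (Fin 2) ℝ).toBasis, Matrix.det_fin_two]
  simp only [LinearMap.toMatrix_apply, OrthonormalBasis.coe_toBasis,
    OrthonormalBasis.coe_toBasis_repr_apply, EuclideanSpace.basisFun_repr, edgeMap₂_apply,
    EuclideanSpace.basisFun_apply]
  simp [det₂]
  ring

/-- `Δ₂` read in `ℝ × ℝ`. [folklore] -/
def paramTriangleProd : Set (ℝ × ℝ) := {x | 0 ≤ x.1 ∧ 0 ≤ x.2 ∧ x.1 + x.2 ≤ 1}

/-- `Δ₂ ⊂ ℝ × ℝ` is measurable. [folklore] -/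
private theorem measurableSet_paramTriangleProd : MeasurableSet paramTriangleProd := by
  have h1 : MeasurableSet {x : ℝ × ℝ | 0 ≤ x.1} := measurableSet_le measurable_const measurable_fst
  have h2 : MeasurableSet {x : ℝ × ℝ | 0 ≤ x.2} := measurableSet_le measurable_const measurable_snd
  have h3 : MeasurableSet {x : ℝ × ℝ | x.1 + x.2 ≤ 1} :=
    measurableSet_le (measurable_fst.add measurable_snd) measurable_const
  have : paramTriangleProd = {x : ℝ × ℝ | 0 ≤ x.1} ∩ ({x | 0 ≤ x.2} ∩ {x | x.1 + x.2 ≤ 1}) := by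
    ext x; simp [paramTriangleProd]
  rw [this]
  exact h1.inter (h2.inter h3)

/-- The slices of `Δ₂ ⊂ ℝ × ℝ` are the intervals `[0, 1 - a]` (`0 ≤ a`), else empty. [folklore] -/
private theorem slice_paramTriangleProd (a : ℝ) :
    Prod.mk a ⁻¹' paramTriangleProd = if 0 ≤ a then Icc 0 (1 - a) else ∅ := by
  ext b
  split_ifs with ha
  · simp only [paramTriangleProd, mem_preimage, mem_setOf_eq, ha, true_and, mem_Icc]
    constructor <;> rintro ⟨h1, h2⟩ <;> exact ⟨h1, by linarith⟩
  · simp only [paramTriangleProd, mem_preimage, mem_setOf_eq, mem_empty_iff_false, iff_false,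
      not_and]
    exact fun h => absurd h ha

/-- `vol Δ₂ = 1/2` in `ℝ × ℝ` (Fubini). [folklore] -/
private theorem volume_paramTriangleProd : volume paramTriangleProd = ENNReal.ofReal (1 / 2) := by
  rw [Measure.volume_eq_prod, Measure.prod_apply measurableSet_paramTriangleProd]
  simp_rw [slice_paramTriangleProd]
  have hslice : ∀ a : ℝ, volume (if 0 ≤ a then Icc 0 (1 - a) else ∅) =
      (Icc (0 : ℝ) 1).indicator (fun a => ENNReal.ofReal (1 - a)) a := by
    intro a
    by_cases ha : 0 ≤ a
    · by_cases ha1 : a ≤ 1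
      · rw [if_pos ha, indicator_of_mem (mem_Icc.2 ⟨ha, ha1⟩), Real.volume_Icc, sub_zero]
      · rw [if_pos ha, indicator_of_notMem (fun h => ha1 (mem_Icc.1 h).2),
          Icc_eq_empty (by linarith), measure_empty]
    · rw [if_neg ha, indicator_of_notMem (fun h => ha (mem_Icc.1 h).1), measure_empty]
  simp_rw [hslice]
  rw [lintegral_indicator measurableSet_Icc, ← ofReal_integral_eq_lintegral_ofReal]
  · rw [integral_Icc_eq_integral_Ioc, ← intervalIntegral.integral_of_le zero_le_one,
      intervalIntegral.integral_sub intervalIntegrable_const intervalIntegral.intervalIntegrable_id,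
      intervalIntegral.integral_const, integral_id]
    norm_num
  · exact Continuous.integrableOn_Icc (by fun_prop)
  · rw [Filter.EventuallyLE, ae_restrict_iff' measurableSet_Icc]
    exact ae_of_all _ fun a ha => by
      have : 0 ≤ 1 - a := by linarith [ha.2]
      simpa using this

/-- `vol Δ₂ = 1/2` (in `ℝ²`). [folklore] -/
private theorem volume_paramTriangle : volume paramTriangle = ENNReal.ofReal (1 / 2) := by
  have h : paramTriangle =
      WithLp.ofLp ⁻¹' (MeasurableEquiv.finTwoArrow ⁻¹' paramTriangleProd) := by
    ext t; simp [paramTriangle, paramTriangleProd]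
  rw [h, (PiLp.volume_preserving_ofLp (Fin 2)).measure_preimage
      ((measurableSet_paramTriangleProd.preimage
        (MeasurableEquiv.finTwoArrow (α := ℝ)).measurable).nullMeasurableSet),
    (volume_preserving_finTwoArrow ℝ).measure_preimage
      measurableSet_paramTriangleProd.nullMeasurableSet, volume_paramTriangleProd]

/-- **`meas(conv{p, q, r}) = ½ |det(q - p, r - p)|`**: the Lebesgue measure of a triangle is its
area (translation invariance, `μ(L(Δ₂)) = |det L| μ(Δ₂)` and `μ(Δ₂) = ½`) — the reading of
`meas(conv(Y))` in (30) as the area of the triangle `Y` ("Heron's formula, which gives the area of a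
triangle in terms of it side lengths, yields `meas(conv(Y)) = …`"; with
`sixteen_mul_triangleArea_sq`). [cite: Theil2006, §2.4 proof of Lemma 2.10 (preprint p. 10)] -/
theorem volume_convexHull_triple (p q r : Plane) :
    volume (convexHull ℝ ({p, q, r} : Set Plane)) = ENNReal.ofReal (triangleArea p q r) := by
  rw [convexHull_triple_eq_image,
    show (fun t => p + edgeMap₂ (q - p) (r - p) t) '' paramTriangle =
      (fun x => p + x) '' (edgeMap₂ (q - p) (r - p) '' paramTriangle) by
        rw [Set.image_image],
    Set.image_add_left, measure_preimage_add, Measure.addHaar_image_linearMap, det_edgeMap₂,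
    volume_paramTriangle, ← ENNReal.ofReal_mul (abs_nonneg _), triangleArea]
  congr 1
  ring

/-- `meas(conv{p, q, r})` as a real number is the area `½ |det(q - p, r - p)|` (the reading of
`meas(conv(Y))` in (30)). [cite: Theil2006, §2.4 proof of Lemma 2.10 (preprint p. 10)] -/
theorem volume_convexHull_triple_toReal (p q r : Plane) :
    (volume (convexHull ℝ ({p, q, r} : Set Plane))).toReal = triangleArea p q r := by
  rw [volume_convexHull_triple, ENNReal.toReal_ofReal (triangleArea_nonneg p q r)]

/-! ## Heron's formula and the expansion of the area about the equilateral triangle -/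

/-- `|p - q|² = (p₀ - q₀)² + (p₁ - q₁)²`. [folklore] -/
private theorem dist_sq_eq (p q : Plane) : dist p q ^ 2 = (p 0 - q 0) ^ 2 + (p 1 - q 1) ^ 2 := by
  rw [EuclideanSpace.dist_eq, Real.sq_sqrt (Finset.sum_nonneg fun i _ => sq_nonneg _),
    Fin.sum_univ_two, Real.dist_eq, Real.dist_eq, sq_abs, sq_abs]

/-- **Heron's formula** (polynomial form): `16 · area² = 2a²b² + 2b²c² + 2c²a² - a⁴ - b⁴ - c⁴`
for the side lengths `a = |p - q|`, `b = |p - r|`, `c = |q - r|` of the triangle `p q r` — the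
first step of the printed proof ("Heron's formula, which gives the area of a triangle in terms of
it side lengths"). [cite: Theil2006, §2.4 proof of Lemma 2.10 (preprint p. 10)] -/
theorem sixteen_mul_triangleArea_sq (p q r : Plane) :
    16 * triangleArea p q r ^ 2 =
      2 * dist p q ^ 2 * dist p r ^ 2 + 2 * dist p r ^ 2 * dist q r ^ 2
        + 2 * dist q r ^ 2 * dist p q ^ 2 - dist p q ^ 4 - dist p r ^ 4 - dist q r ^ 4 := by
  have h4 : ∀ a b : Plane, dist a b ^ 4 = (dist a b ^ 2) ^ 2 := fun a b => by ring
  rw [h4, h4, h4, dist_sq_eq, dist_sq_eq, dist_sq_eq, triangleArea, div_pow, sq_abs, det₂]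
  simp only [PiLp.sub_apply]
  ring

/-- Quadratic part of the Heron expansion: `|-(5/24) Σ εᵢ² + (1/3) Σ_{i<j} εᵢ εⱼ| ≤ (13/24) Σ εᵢ²`.
[folklore] -/
private theorem quad_part_bound (e₁ e₂ e₃ : ℝ) :
    |-(5 / 24) * (e₁ ^ 2 + e₂ ^ 2 + e₃ ^ 2) + 1 / 3 * (e₁ * e₂ + e₁ * e₃ + e₂ * e₃)|
      ≤ 13 / 24 * (e₁ ^ 2 + e₂ ^ 2 + e₃ ^ 2) := by
  rw [abs_le]
  constructor
  · nlinarith [sq_nonneg (e₁ + e₂), sq_nonneg (e₁ + e₃), sq_nonneg (e₂ + e₃)]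
  · nlinarith [sq_nonneg (e₁ - e₂), sq_nonneg (e₁ - e₃), sq_nonneg (e₂ - e₃)]

/-- Cubic part of the Heron expansion: for `|εᵢ| ≤ t`,
`|¼ (Σ_{i≠j} εᵢ² εⱼ - Σ εᵢ³)| ≤ ¾ t Σ εᵢ²`. [folklore] -/
private theorem cubic_part_bound {t e₁ e₂ e₃ : ℝ} (h₁ : |e₁| ≤ t) (h₂ : |e₂| ≤ t)
    (h₃ : |e₃| ≤ t) :
    |1 / 4 * (e₁ ^ 2 * e₂ + e₁ ^ 2 * e₃ + e₂ ^ 2 * e₁ + e₂ ^ 2 * e₃ + e₃ ^ 2 * e₁ + e₃ ^ 2 * e₂)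
        - 1 / 4 * (e₁ ^ 3 + e₂ ^ 3 + e₃ ^ 3)| ≤ 3 / 4 * t * (e₁ ^ 2 + e₂ ^ 2 + e₃ ^ 2) := by
  obtain ⟨h₁l, h₁u⟩ := abs_le.1 h₁
  obtain ⟨h₂l, h₂u⟩ := abs_le.1 h₂
  obtain ⟨h₃l, h₃u⟩ := abs_le.1 h₃
  have p₁ : 0 ≤ t + e₁ := by linarith
  have p₂ : 0 ≤ t + e₂ := by linarith
  have p₃ : 0 ≤ t + e₃ := by linarith
  have m₁ : 0 ≤ t - e₁ := by linarith
  have m₂ : 0 ≤ t - e₂ := by linarith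
  have m₃ : 0 ≤ t - e₃ := by linarith
  have s₁ := sq_nonneg e₁
  have s₂ := sq_nonneg e₂
  have s₃ := sq_nonneg e₃
  rw [abs_le]
  constructor
  · nlinarith [mul_nonneg s₁ m₁, mul_nonneg s₁ p₂, mul_nonneg s₁ p₃, mul_nonneg s₂ m₂,
      mul_nonneg s₂ p₁, mul_nonneg s₂ p₃, mul_nonneg s₃ m₃, mul_nonneg s₃ p₁, mul_nonneg s₃ p₂]
  · nlinarith [mul_nonneg s₁ p₁, mul_nonneg s₁ m₂, mul_nonneg s₁ m₃, mul_nonneg s₂ p₂,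
      mul_nonneg s₂ m₁, mul_nonneg s₂ m₃, mul_nonneg s₃ p₃, mul_nonneg s₃ m₁, mul_nonneg s₃ m₂]

/-- Quartic part of the Heron expansion: for `|εᵢ| ≤ t`,
`|-(1/16) Σ εᵢ⁴ + (1/8) Σ_{i<j} εᵢ² εⱼ²| ≤ (5/16) t² Σ εᵢ²`. [folklore] -/
private theorem quartic_part_bound {t e₁ e₂ e₃ : ℝ} (h₁ : |e₁| ≤ t) (h₂ : |e₂| ≤ t)
    (h₃ : |e₃| ≤ t) :
    |-(1 / 16) * (e₁ ^ 4 + e₂ ^ 4 + e₃ ^ 4)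
        + 1 / 8 * (e₁ ^ 2 * e₂ ^ 2 + e₁ ^ 2 * e₃ ^ 2 + e₂ ^ 2 * e₃ ^ 2)|
      ≤ 5 / 16 * t ^ 2 * (e₁ ^ 2 + e₂ ^ 2 + e₃ ^ 2) := by
  have q₁ : e₁ ^ 2 ≤ t ^ 2 := sq_le_sq' (abs_le.1 h₁).1 (abs_le.1 h₁).2
  have q₂ : e₂ ^ 2 ≤ t ^ 2 := sq_le_sq' (abs_le.1 h₂).1 (abs_le.1 h₂).2
  have q₃ : e₃ ^ 2 ≤ t ^ 2 := sq_le_sq' (abs_le.1 h₃).1 (abs_le.1 h₃).2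
  have s₁ := sq_nonneg e₁
  have s₂ := sq_nonneg e₂
  have s₃ := sq_nonneg e₃
  rw [abs_le]
  constructor
  · nlinarith [mul_nonneg s₁ (sub_nonneg.2 q₁), mul_nonneg s₂ (sub_nonneg.2 q₂),
      mul_nonneg s₃ (sub_nonneg.2 q₃), mul_nonneg s₁ s₂, mul_nonneg s₁ s₃, mul_nonneg s₂ s₃]
  · nlinarith [mul_nonneg s₂ (sub_nonneg.2 q₁), mul_nonneg s₃ (sub_nonneg.2 q₁),
      mul_nonneg s₃ (sub_nonneg.2 q₂), mul_nonneg s₁ s₁, mul_nonneg s₂ s₂, mul_nonneg s₃ s₃]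

/-- **The algebraic core of Heron's expansion.** With side lengths `λ + εᵢ`, `|εᵢ| ≤ λ`, Heron's
polynomial differs from `16 (√3/4 λ² + (√3/6) λ Σ εᵢ)² = 48 (λ²/4 + λ Σ εᵢ / 6)²` (constant and
linear terms cancel) by at most `32 λ² Σ εᵢ²`. [folklore] -/
private theorem heron_expansion_bound {lam e₁ e₂ e₃ : ℝ} (h₁ : |e₁| ≤ lam) (h₂ : |e₂| ≤ lam)
    (h₃ : |e₃| ≤ lam) :
    |(2 * (lam + e₁) ^ 2 * (lam + e₂) ^ 2 + 2 * (lam + e₂) ^ 2 * (lam + e₃) ^ 2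
        + 2 * (lam + e₃) ^ 2 * (lam + e₁) ^ 2
        - (lam + e₁) ^ 4 - (lam + e₂) ^ 4 - (lam + e₃) ^ 4) / 16
      - 3 * (lam ^ 2 / 4 + lam * (e₁ + e₂ + e₃) / 6) ^ 2|
      ≤ 2 * lam ^ 2 * (e₁ ^ 2 + e₂ ^ 2 + e₃ ^ 2) := by
  have hlam : 0 ≤ lam := (abs_nonneg e₁).trans h₁
  have hQ := quad_part_bound e₁ e₂ e₃
  have hC := cubic_part_bound h₁ h₂ h₃
  have hR := quartic_part_bound h₁ h₂ h₃
  have key : (2 * (lam + e₁) ^ 2 * (lam + e₂) ^ 2 + 2 * (lam + e₂) ^ 2 * (lam + e₃) ^ 2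
        + 2 * (lam + e₃) ^ 2 * (lam + e₁) ^ 2
        - (lam + e₁) ^ 4 - (lam + e₂) ^ 4 - (lam + e₃) ^ 4) / 16
      - 3 * (lam ^ 2 / 4 + lam * (e₁ + e₂ + e₃) / 6) ^ 2 =
      lam ^ 2 * (-(5 / 24) * (e₁ ^ 2 + e₂ ^ 2 + e₃ ^ 2) + 1 / 3 * (e₁ * e₂ + e₁ * e₃ + e₂ * e₃))
      + lam * (1 / 4 * (e₁ ^ 2 * e₂ + e₁ ^ 2 * e₃ + e₂ ^ 2 * e₁ + e₂ ^ 2 * e₃ + e₃ ^ 2 * e₁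
          + e₃ ^ 2 * e₂) - 1 / 4 * (e₁ ^ 3 + e₂ ^ 3 + e₃ ^ 3))
      + (-(1 / 16) * (e₁ ^ 4 + e₂ ^ 4 + e₃ ^ 4)
          + 1 / 8 * (e₁ ^ 2 * e₂ ^ 2 + e₁ ^ 2 * e₃ ^ 2 + e₂ ^ 2 * e₃ ^ 2)) := by
    ring
  rw [key]
  have hl2 : 0 ≤ lam ^ 2 := sq_nonneg lam
  calc _ ≤ |lam ^ 2 * (-(5 / 24) * (e₁ ^ 2 + e₂ ^ 2 + e₃ ^ 2)
            + 1 / 3 * (e₁ * e₂ + e₁ * e₃ + e₂ * e₃))|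
          + |lam * (1 / 4 * (e₁ ^ 2 * e₂ + e₁ ^ 2 * e₃ + e₂ ^ 2 * e₁ + e₂ ^ 2 * e₃ + e₃ ^ 2 * e₁
            + e₃ ^ 2 * e₂) - 1 / 4 * (e₁ ^ 3 + e₂ ^ 3 + e₃ ^ 3))|
          + |-(1 / 16) * (e₁ ^ 4 + e₂ ^ 4 + e₃ ^ 4)
            + 1 / 8 * (e₁ ^ 2 * e₂ ^ 2 + e₁ ^ 2 * e₃ ^ 2 + e₂ ^ 2 * e₃ ^ 2)| :=
        abs_add_three _ _ _
    _ ≤ lam ^ 2 * (13 / 24 * (e₁ ^ 2 + e₂ ^ 2 + e₃ ^ 2))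
          + lam * (3 / 4 * lam * (e₁ ^ 2 + e₂ ^ 2 + e₃ ^ 2))
          + 5 / 16 * lam ^ 2 * (e₁ ^ 2 + e₂ ^ 2 + e₃ ^ 2) := by
        gcongr
        · rw [abs_mul, abs_of_nonneg hl2]
          exact mul_le_mul_of_nonneg_left hQ hl2
        · rw [abs_mul, abs_of_nonneg hlam]
          exact mul_le_mul_of_nonneg_left hC hlam
    _ ≤ 2 * lam ^ 2 * (e₁ ^ 2 + e₂ ^ 2 + e₃ ^ 2) := by
        nlinarith [sq_nonneg e₁, sq_nonneg e₂, sq_nonneg e₃]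

/-- **Heron's formula to second order about the equilateral triangle** (Theil 2006, proof of
Lemma 2.10: "Heron's formula … yields `meas(conv(Y)) = (√3/4)λ²(1 + ⅔ Σ_{i≠j} δᵢⱼ + O(Σ δᵢⱼ²))^½
= (√3/4)λ² + (1/(4√3)) λ² Σ_{i≠j} δᵢⱼ + O(λ² Σ δᵢⱼ²)`, where the `O`-constant is bounded by a
universal number"): if the three side lengths are within `λ/4` of `λ > 0`, then
`|area - (√3/4) λ² - (√3/6) λ Σ_{pairs} (|yᵢ - yⱼ| - λ)| ≤ 10 Σ_{pairs} (|yᵢ - yⱼ| - λ)²`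
(`(√3/6) λ Σ_{pairs} = (1/(4√3)) λ² Σ_{i≠j} δᵢⱼ` with `δᵢⱼ = |yᵢ - yⱼ|/λ - 1`; explicit constant
`10 ≥ 16/√3`, closeness `¼` in place of the paper's unquantified `α₀`).
[cite: Theil2006, §2.4 proof of Lemma 2.10 (preprint p. 10)] -/
theorem abs_triangleArea_sub_le {lam : ℝ} (hlam : 0 < lam) {p q r : Plane}
    (h₁ : |dist p q - lam| ≤ lam / 4) (h₂ : |dist p r - lam| ≤ lam / 4)
    (h₃ : |dist q r - lam| ≤ lam / 4) :
    |triangleArea p q r - (√3 / 4 * lam ^ 2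
        + √3 / 6 * lam * ((dist p q - lam) + (dist p r - lam) + (dist q r - lam)))|
      ≤ 10 * ((dist p q - lam) ^ 2 + (dist p r - lam) ^ 2 + (dist q r - lam) ^ 2) := by
  set e₁ := dist p q - lam with he₁
  set e₂ := dist p r - lam with he₂
  set e₃ := dist q r - lam with he₃
  set A := triangleArea p q r with hA
  set B := √3 / 4 * lam ^ 2 + √3 / 6 * lam * (e₁ + e₂ + e₃) with hB
  have h3 : √3 * √3 = (3 : ℝ) := Real.mul_self_sqrt (by norm_num)
  have h3l : (8 : ℝ) / 5 ≤ √3 := by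
    rw [show (8 : ℝ) / 5 = √((8 / 5) ^ 2) by rw [Real.sqrt_sq (by norm_num)]]
    exact Real.sqrt_le_sqrt (by norm_num)
  have hA0 : 0 ≤ A := triangleArea_nonneg p q r
  -- `B ≥ (√3/8) λ² > 0`
  have hS : -(3 / 4 * lam) ≤ e₁ + e₂ + e₃ := by
    linarith [(abs_le.1 h₁).1, (abs_le.1 h₂).1, (abs_le.1 h₃).1]
  have hBl : √3 / 8 * lam ^ 2 ≤ B := by
    rw [hB]
    have : 0 ≤ √3 * lam * (e₁ + e₂ + e₃ + 3 / 4 * lam) :=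
      mul_nonneg (mul_nonneg (Real.sqrt_nonneg 3) hlam.le) (by linarith)
    nlinarith [this]
  have hB0 : 0 < B := lt_of_lt_of_le (by positivity) hBl
  -- `A² - B²` is the Heron expansion
  have hAsq : A ^ 2 = (2 * (lam + e₁) ^ 2 * (lam + e₂) ^ 2 + 2 * (lam + e₂) ^ 2 * (lam + e₃) ^ 2
        + 2 * (lam + e₃) ^ 2 * (lam + e₁) ^ 2
        - (lam + e₁) ^ 4 - (lam + e₂) ^ 4 - (lam + e₃) ^ 4) / 16 := by
    have h16 := sixteen_mul_triangleArea_sq p q r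
    rw [show dist p q = lam + e₁ by rw [he₁]; ring, show dist p r = lam + e₂ by rw [he₂]; ring,
      show dist q r = lam + e₃ by rw [he₃]; ring] at h16
    rw [← hA] at h16
    linarith
  have hBsq : B ^ 2 = 3 * (lam ^ 2 / 4 + lam * (e₁ + e₂ + e₃) / 6) ^ 2 := by
    rw [hB]
    have : √3 / 4 * lam ^ 2 + √3 / 6 * lam * (e₁ + e₂ + e₃) =
        √3 * (lam ^ 2 / 4 + lam * (e₁ + e₂ + e₃) / 6) := by ring
    rw [this, mul_pow, show √3 ^ 2 = (3 : ℝ) by rw [sq, h3]]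
  have hl4 : lam / 4 ≤ lam := by linarith
  have hcore := heron_expansion_bound (h₁.trans hl4) (h₂.trans hl4) (h₃.trans hl4)
  rw [← hAsq, ← hBsq] at hcore
  -- `A - B = (A² - B²)/(A + B)`
  have hAB : 0 < A + B := by linarith
  have hdiff : A - B = (A ^ 2 - B ^ 2) / (A + B) := by
    rw [eq_div_iff hAB.ne']; ring
  rw [hdiff, abs_div, abs_of_pos hAB, div_le_iff₀ hAB]
  calc |A ^ 2 - B ^ 2| ≤ 2 * lam ^ 2 * (e₁ ^ 2 + e₂ ^ 2 + e₃ ^ 2) := hcore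
    _ ≤ 10 * (e₁ ^ 2 + e₂ ^ 2 + e₃ ^ 2) * (√3 / 8 * lam ^ 2) := by
        have : 0 ≤ e₁ ^ 2 + e₂ ^ 2 + e₃ ^ 2 := by positivity
        nlinarith [sq_nonneg lam, mul_nonneg this (sq_nonneg lam)]
    _ ≤ 10 * (e₁ ^ 2 + e₂ ^ 2 + e₃ ^ 2) * (A + B) := by
        gcongr; linarith

/-! ## Taylor's theorem with the second derivative bounded on an open interval -/

/-- On an open half-line where `f ∈ C²`, `f` has derivative `f'`. [folklore] -/
private theorem hasDerivAt_of_contDiffOn_Ioi {f : ℝ → ℝ} {a x : ℝ}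
    (hf : ContDiffOn ℝ 2 f (Ioi a)) (hx : a < x) : HasDerivAt f (deriv f x) x :=
  ((hf.differentiableOn (by norm_num)).differentiableAt (Ioi_mem_nhds hx)).hasDerivAt

/-- On an open half-line where `f ∈ C²`, `f'` has derivative `f''`. [folklore] -/
private theorem hasDerivAt_deriv_of_contDiffOn_Ioi {f : ℝ → ℝ} {a x : ℝ}
    (hf : ContDiffOn ℝ 2 f (Ioi a)) (hx : a < x) : HasDerivAt (deriv f) (deriv^[2] f x) x := by
  show HasDerivAt (deriv f) (deriv (deriv f) x) x
  exact (((hf.deriv_of_isOpen isOpen_Ioi (m := 1) (by norm_num)).differentiableOn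
    (by norm_num)).differentiableAt (Ioi_mem_nhds hx)).hasDerivAt

/-- **Taylor to second order** ("By Taylor's theorem
`|f(|yᵢ - yⱼ|) - f(λ) - λ f'(λ) δᵢⱼ| ≤ (λ²/2) ‖f''‖_{L^∞((1-α)λ,∞)} δᵢⱼ²`"): if `f ∈ C²` beyond
`a < lo` and `|f''| ≤ M` on the open interval `(lo, hi)`, then for `c, x ∈ [lo, hi]`,
`|f(x) - f(c) - f'(c)(x - c)| ≤ M (x - c)²` (two applications of the mean value theorem; the
constant `1` instead of `½` is immaterial here). [cite: Theil2006, §2.4 proof of Lemma 2.10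
(preprint p. 10)] -/
theorem abs_sub_sub_deriv_mul_le {f : ℝ → ℝ} {a lo hi c x M : ℝ}
    (hf : ContDiffOn ℝ 2 f (Ioi a)) (ha : a < lo) (hc : c ∈ Icc lo hi) (hx : x ∈ Icc lo hi)
    (hM : ∀ t ∈ Ioo lo hi, |deriv^[2] f t| ≤ M) :
    |f x - f c - deriv f c * (x - c)| ≤ M * (x - c) ^ 2 := by
  have hdf : ∀ t, lo ≤ t → HasDerivAt f (deriv f t) t := fun t ht =>
    hasDerivAt_of_contDiffOn_Ioi hf (ha.trans_le ht)
  have hddf : ∀ t, lo ≤ t → HasDerivAt (deriv f) (deriv^[2] f t) t := fun t ht =>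
    hasDerivAt_deriv_of_contDiffOn_Ioi hf (ha.trans_le ht)
  have hfc : ∀ u v, lo ≤ u → ContinuousOn f (Icc u v) := fun u v hu t ht =>
    (hdf t (hu.trans ht.1)).continuousAt.continuousWithinAt
  have hfd : ∀ u v, lo ≤ u → DifferentiableOn ℝ f (Ioo u v) := fun u v hu t ht =>
    (hdf t (hu.trans ht.1.le)).differentiableAt.differentiableWithinAt
  have hdfc : ∀ u v, lo ≤ u → ContinuousOn (deriv f) (Icc u v) := fun u v hu t ht =>
    (hddf t (hu.trans ht.1)).continuousAt.continuousWithinAt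
  have hdfd : ∀ u v, lo ≤ u → DifferentiableOn ℝ (deriv f) (Ioo u v) := fun u v hu t ht =>
    (hddf t (hu.trans ht.1.le)).differentiableAt.differentiableWithinAt
  rcases lt_trichotomy c x with hcx | rfl | hxc
  · obtain ⟨ξ, hξ, hξeq⟩ := exists_deriv_eq_slope f hcx (hfc c x hc.1) (hfd c x hc.1)
    obtain ⟨η, hη, hηeq⟩ :=
      exists_deriv_eq_slope (deriv f) hξ.1 (hdfc c ξ hc.1) (hdfd c ξ hc.1)
    have h1 : f x - f c = deriv f ξ * (x - c) := by
      rw [hξeq, div_mul_cancel₀ _ (sub_ne_zero.2 hcx.ne')]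
    have h2 : deriv f ξ - deriv f c = deriv^[2] f η * (ξ - c) := by
      show _ = deriv (deriv f) η * _
      rw [hηeq, div_mul_cancel₀ _ (sub_ne_zero.2 hξ.1.ne')]
    have hηM : |deriv^[2] f η| ≤ M :=
      hM η ⟨lt_of_le_of_lt hc.1 hη.1, hη.2.trans (hξ.2.trans_le hx.2)⟩
    have hM0 : 0 ≤ M := (abs_nonneg _).trans hηM
    have hprod : 0 ≤ (ξ - c) * (x - c) := mul_nonneg (by linarith [hη.1, hη.2]) (by linarith)
    calc |f x - f c - deriv f c * (x - c)| = |deriv^[2] f η| * ((ξ - c) * (x - c)) := by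
          rw [h1, ← sub_mul, h2, mul_assoc, abs_mul, abs_of_nonneg hprod]
      _ ≤ M * ((ξ - c) * (x - c)) := mul_le_mul_of_nonneg_right hηM hprod
      _ ≤ M * (x - c) ^ 2 := by
          apply mul_le_mul_of_nonneg_left _ hM0
          nlinarith [hξ.1, hξ.2]
  · simp
  · obtain ⟨ξ, hξ, hξeq⟩ := exists_deriv_eq_slope f hxc (hfc x c hx.1) (hfd x c hx.1)
    obtain ⟨η, hη, hηeq⟩ :=
      exists_deriv_eq_slope (deriv f) hξ.2 (hdfc ξ c (hx.1.trans hξ.1.le))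
        (hdfd ξ c (hx.1.trans hξ.1.le))
    have h1 : f c - f x = deriv f ξ * (c - x) := by
      rw [hξeq, div_mul_cancel₀ _ (sub_ne_zero.2 hxc.ne')]
    have h2 : deriv f c - deriv f ξ = deriv^[2] f η * (c - ξ) := by
      show _ = deriv (deriv f) η * _
      rw [hηeq, div_mul_cancel₀ _ (sub_ne_zero.2 hξ.2.ne')]
    have hηM : |deriv^[2] f η| ≤ M :=
      hM η ⟨lt_of_le_of_lt hx.1 (hξ.1.trans hη.1), lt_of_lt_of_le hη.2 hc.2⟩
    have hM0 : 0 ≤ M := (abs_nonneg _).trans hηM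
    have hprod : 0 ≤ (c - ξ) * (c - x) := mul_nonneg (by linarith [hη.1, hη.2]) (by linarith)
    calc |f x - f c - deriv f c * (x - c)| = |deriv^[2] f η| * ((c - ξ) * (c - x)) := by
          rw [show f x - f c - deriv f c * (x - c) = (deriv f c - deriv f ξ) * (c - x) by
              rw [sub_mul, ← h1]; ring,
            h2, mul_assoc, abs_mul, abs_of_nonneg hprod]
      _ ≤ M * ((c - ξ) * (c - x)) := mul_le_mul_of_nonneg_right hηM hprod
      _ ≤ M * (x - c) ^ 2 := by
          apply mul_le_mul_of_nonneg_left _ hM0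
          nlinarith [hξ.1, hξ.2]

/-! ## Lemma 2.10 -/

/-- `|d/λ - 1| ≤ α` iff `|d - λ| ≤ α λ` (`λ > 0`); the forward direction. [folklore] -/
private theorem abs_sub_le_of_abs_div_sub_one_le {d lam α : ℝ} (hlam : 0 < lam)
    (h : |d / lam - 1| ≤ α) : |d - lam| ≤ α * lam := by
  have : d / lam - 1 = (d - lam) / lam := by field_simp
  rwa [this, abs_div, abs_of_pos hlam, div_le_iff₀ hlam] at h

/-- The bookkeeping of the proof of Lemma 2.10, in scalar variables: with
`B = (√3/4)λ² + (√3/6) λ S`, `S = Σ (dᵢ - λ)`, one has `(2√3/λ) f' (B - (√3/4)λ²) = f' S`, so the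
left side of (30) equals `(2√3/λ) f' (A - B) - Σᵢ (fᵢ - f₀ - f'(dᵢ - λ))`, and the Heron and
Taylor bounds add up (`20√3 ≤ 40`). [folklore] -/
private theorem combine {A d₁ d₂ d₃ lam f₀ f₁ f₂ f₃ f' M : ℝ} (hlam : 0 < lam) (hM0 : 0 ≤ M)
    (harea : |A - (√3 / 4 * lam ^ 2 + √3 / 6 * lam * ((d₁ - lam) + (d₂ - lam) + (d₃ - lam)))|
      ≤ 10 * ((d₁ - lam) ^ 2 + (d₂ - lam) ^ 2 + (d₃ - lam) ^ 2))
    (T₁ : |f₁ - f₀ - f' * (d₁ - lam)| ≤ M * (d₁ - lam) ^ 2)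
    (T₂ : |f₂ - f₀ - f' * (d₂ - lam)| ≤ M * (d₂ - lam) ^ 2)
    (T₃ : |f₃ - f₀ - f' * (d₃ - lam)| ≤ M * (d₃ - lam) ^ 2) :
    |2 * √3 / lam * f' * (A - √3 / 4 * lam ^ 2) + 3 * f₀ - (f₁ + f₂ + f₃)|
      ≤ 40 * (|f'| / lam + M) * ((d₁ - lam) ^ 2 + (d₂ - lam) ^ 2 + (d₃ - lam) ^ 2) := by
  set S := (d₁ - lam) + (d₂ - lam) + (d₃ - lam) with hS
  set Q := (d₁ - lam) ^ 2 + (d₂ - lam) ^ 2 + (d₃ - lam) ^ 2 with hQ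
  set B := √3 / 4 * lam ^ 2 + √3 / 6 * lam * S with hB
  have h3 : √3 * √3 = (3 : ℝ) := Real.mul_self_sqrt (by norm_num)
  have hK : 2 * √3 / lam * f' * (√3 / 6 * lam * S) = f' * S := by
    calc 2 * √3 / lam * f' * (√3 / 6 * lam * S)
        = (2 * (√3 * √3) / 6) * (lam / lam) * (f' * S) := by ring
      _ = f' * S := by rw [h3, div_self hlam.ne']; ring
  have hE : 2 * √3 / lam * f' * (A - √3 / 4 * lam ^ 2) + 3 * f₀ - (f₁ + f₂ + f₃)
      = 2 * √3 / lam * f' * (A - B)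
        - ((f₁ - f₀ - f' * (d₁ - lam)) + (f₂ - f₀ - f' * (d₂ - lam))
          + (f₃ - f₀ - f' * (d₃ - lam))) := by
    have : 2 * √3 / lam * f' * (A - √3 / 4 * lam ^ 2) =
        2 * √3 / lam * f' * (A - B) + 2 * √3 / lam * f' * (√3 / 6 * lam * S) := by
      rw [hB]; ring
    rw [this, hK, hS]; ring
  rw [hE]
  have hQ0 : 0 ≤ Q := by positivity
  have hu : 0 ≤ |f'| / lam := by positivity
  have h3u : √3 ≤ 2 := by
    rw [show (2 : ℝ) = √(2 ^ 2) by rw [Real.sqrt_sq (by norm_num)]]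
    exact Real.sqrt_le_sqrt (by norm_num)
  have hfirst : |2 * √3 / lam * f' * (A - B)| ≤ 2 * √3 / lam * |f'| * (10 * Q) := by
    rw [abs_mul, abs_mul, abs_div, abs_of_pos (by positivity : (0 : ℝ) < 2 * √3),
      abs_of_pos hlam]
    exact mul_le_mul_of_nonneg_left harea (by positivity)
  have hsecond : |(f₁ - f₀ - f' * (d₁ - lam)) + (f₂ - f₀ - f' * (d₂ - lam))
      + (f₃ - f₀ - f' * (d₃ - lam))| ≤ M * Q := by
    calc _ ≤ |f₁ - f₀ - f' * (d₁ - lam)| + |f₂ - f₀ - f' * (d₂ - lam)|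
          + |f₃ - f₀ - f' * (d₃ - lam)| := abs_add_three _ _ _
      _ ≤ M * (d₁ - lam) ^ 2 + M * (d₂ - lam) ^ 2 + M * (d₃ - lam) ^ 2 :=
          add_le_add_three T₁ T₂ T₃
      _ = M * Q := by rw [hQ]; ring
  have h1 : 0 ≤ (2 - √3) * (|f'| / lam * Q) :=
    mul_nonneg (sub_nonneg.2 h3u) (mul_nonneg hu hQ0)
  have h2 : 0 ≤ M * Q := mul_nonneg hM0 hQ0
  calc _ ≤ |2 * √3 / lam * f' * (A - B)|
          + |(f₁ - f₀ - f' * (d₁ - lam)) + (f₂ - f₀ - f' * (d₂ - lam))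
            + (f₃ - f₀ - f' * (d₃ - lam))| := abs_sub _ _
    _ ≤ 2 * √3 / lam * |f'| * (10 * Q) + M * Q := add_le_add hfirst hsecond
    _ = 20 * √3 * (|f'| / lam * Q) + M * Q := by ring
    _ ≤ 40 * (|f'| / lam * Q) + 40 * (M * Q) := by linarith
    _ = 40 * (|f'| / lam + M) * Q := by ring

/-- **Theil 2006, Lemma 2.10, for one triangle `p q r` with explicit constants.** If `f` is `C²`
on an open half-line `(a, ∞)` containing `[(1-α)λ, (1+α)λ]`, `0 < α ≤ ¼`, the three side lengths
satisfy `|(1/λ)|yᵢ - yⱼ| - 1| ≤ α` and `|f''| ≤ M` on `((1-α)λ, (1+α)λ)`, then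
`|(2√3/λ) f'(λ) (meas(conv Y) - (√3/4)λ²) + 3 f(λ) - Σ_{pairs} f(|yᵢ - yⱼ|)|
 ≤ 40 (|f'(λ)|/λ + M) Σ_{pairs} (|yᵢ - yⱼ| - λ)²`
(`meas(conv Y) = triangleArea p q r` by `volume_convexHull_triple_toReal`). The printed
`f ∈ C²([0,∞))` is the case `a = 0` (`exists_simplex_expansion_bound`); the half-line form is the
one used for `V ∈ C²(1-α, ∞)` in (31). Proof as printed: Heron (`abs_triangleArea_sub_le`) and
Taylor (`abs_sub_sub_deriv_mul_le`), the linear terms cancelling because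
`(2√3/λ) · (√3/6) λ = 1`. [cite: Theil2006, §2.4 Lemma 2.10 (30) (preprint p. 10)] -/
theorem simplex_expansion_bound {α lam a M : ℝ} {f : ℝ → ℝ} (hα0 : 0 < α) (hα : α ≤ 1 / 4)
    (hlam : 0 < lam) (hf : ContDiffOn ℝ 2 f (Ioi a)) (ha : a < (1 - α) * lam) {p q r : Plane}
    (hpq : |dist p q / lam - 1| ≤ α) (hpr : |dist p r / lam - 1| ≤ α)
    (hqr : |dist q r / lam - 1| ≤ α)
    (hM : ∀ t ∈ Ioo ((1 - α) * lam) ((1 + α) * lam), |deriv^[2] f t| ≤ M) :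
    |2 * √3 / lam * deriv f lam * (triangleArea p q r - √3 / 4 * lam ^ 2) + 3 * f lam
        - (f (dist p q) + f (dist p r) + f (dist q r))|
      ≤ 40 * (|deriv f lam| / lam + M)
          * ((dist p q - lam) ^ 2 + (dist p r - lam) ^ 2 + (dist q r - lam) ^ 2) := by
  have e₁b := abs_sub_le_of_abs_div_sub_one_le hlam hpq
  have e₂b := abs_sub_le_of_abs_div_sub_one_le hlam hpr
  have e₃b := abs_sub_le_of_abs_div_sub_one_le hlam hqr
  have hαl : α * lam ≤ lam / 4 := by nlinarith
  have hmem : ∀ {d : ℝ}, |d - lam| ≤ α * lam → d ∈ Icc ((1 - α) * lam) ((1 + α) * lam) := by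
    intro d hd
    obtain ⟨h1, h2⟩ := abs_le.1 hd
    constructor <;> linarith
  have hlo : (1 - α) * lam < lam := by nlinarith
  have hhi : lam < (1 + α) * lam := by nlinarith
  have hc : lam ∈ Icc ((1 - α) * lam) ((1 + α) * lam) := ⟨hlo.le, hhi.le⟩
  exact combine hlam ((abs_nonneg _).trans (hM lam ⟨hlo, hhi⟩))
    (abs_triangleArea_sub_le hlam (e₁b.trans hαl) (e₂b.trans hαl) (e₃b.trans hαl))
    (abs_sub_sub_deriv_mul_le hf ha hc (hmem e₁b) hM)
    (abs_sub_sub_deriv_mul_le hf ha hc (hmem e₂b) hM)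
    (abs_sub_sub_deriv_mul_le hf ha hc (hmem e₃b) hM)

/-- Lemma 2.10 in the printed indexing `Y = {y₀, y₁, y₂}`, `Σ_{i≠j}` over ordered pairs, with
`meas(conv(Y))` the Lebesgue measure of the convex hull and the explicit constants `C = 20`,
`α < ¼`; `M` is any bound of `|f''|` on `((1-α)λ, (1+α)λ)`.
[cite: Theil2006, §2.4 Lemma 2.10 (30) (preprint p. 10)] -/
theorem simplex_expansion_bound_explicit {α lam M : ℝ} {f : ℝ → ℝ} (hα : α ∈ Ioo 0 (1 / 4 : ℝ))
    (hf : ContDiffOn ℝ 2 f (Ici 0)) (hlam : 0 < lam) (y : Fin 3 → Plane)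
    (hy : ∀ i j, i ≠ j → |dist (y i) (y j) / lam - 1| ≤ α)
    (hM : ∀ r ∈ Ioo ((1 - α) * lam) ((1 + α) * lam), |deriv^[2] f r| ≤ M) :
    |2 * √3 / lam * deriv f lam *
          ((volume (convexHull ℝ ({y 0, y 1, y 2} : Set Plane))).toReal - √3 / 4 * lam ^ 2)
        + 3 * f lam - 1 / 2 * ∑ i, ∑ j with j ≠ i, f (dist (y i) (y j))|
      ≤ 20 * (|deriv f lam| / lam + M) * ∑ i, ∑ j with j ≠ i, (dist (y i) (y j) - lam) ^ 2 := by
  have hf' : ContDiffOn ℝ 2 f (Ioi 0) := hf.mono Ioi_subset_Ici_self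
  have ha : (0 : ℝ) < (1 - α) * lam := mul_pos (by linarith [hα.2]) hlam
  have key := simplex_expansion_bound hα.1 hα.2.le hlam hf' ha (hy 0 1 (by decide))
    (hy 0 2 (by decide)) (hy 1 2 (by decide)) hM
  rw [volume_convexHull_triple_toReal]
  have hsum1 : ∑ i, ∑ j with j ≠ i, f (dist (y i) (y j)) =
      2 * (f (dist (y 0) (y 1)) + f (dist (y 0) (y 2)) + f (dist (y 1) (y 2))) := by
    simp [Finset.sum_filter, Fin.sum_univ_three, dist_comm]
    ring
  have hsum2 : ∑ i, ∑ j with j ≠ i, (dist (y i) (y j) - lam) ^ 2 =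
      2 * ((dist (y 0) (y 1) - lam) ^ 2 + (dist (y 0) (y 2) - lam) ^ 2
        + (dist (y 1) (y 2) - lam) ^ 2) := by
    simp [Finset.sum_filter, Fin.sum_univ_three, dist_comm]
    ring
  rw [hsum1, hsum2]
  have hrew : 2 * √3 / lam * deriv f lam * (triangleArea (y 0) (y 1) (y 2) - √3 / 4 * lam ^ 2)
      + 3 * f lam
      - 1 / 2 * (2 * (f (dist (y 0) (y 1)) + f (dist (y 0) (y 2)) + f (dist (y 1) (y 2)))) =
      2 * √3 / lam * deriv f lam * (triangleArea (y 0) (y 1) (y 2) - √3 / 4 * lam ^ 2)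
      + 3 * f lam - (f (dist (y 0) (y 1)) + f (dist (y 0) (y 2)) + f (dist (y 1) (y 2))) := by
    ring
  rw [hrew]
  linarith [key]

/-- **Theil 2006, Lemma 2.10** (verbatim): "There exists two constants `C, α₀ > 0` such that for
all `α ∈ (0, α₀)`, `f ∈ C²([0, ∞))`, `λ ∈ (0, ∞)` and all `Y = {y₀, y₁, y₂} ⊂ ℝ²` with the
property, `|(1/λ)|yᵢ - yⱼ| - 1| ≤ α` for `i ≠ j`, the inequality
(30) `|(2√3/λ) f'(λ) (meas(conv(Y)) - (√3/4) λ²) + 3 f(λ) - ½ Σ_{i≠j} f(|yᵢ - yⱼ|)|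
 ≤ C ((1/λ) |f'(λ)| + ‖f''‖_{L^∞((1-α)λ,(1+α)λ)}) Σ_{i≠j} (|yᵢ - yⱼ| - λ)²` holds."
Rendering: `meas(conv(Y))` is the Lebesgue measure `volume (convexHull ℝ {y 0, y 1, y 2})` of
`ℝ² = EuclideanSpace ℝ (Fin 2)`; `Σ_{i≠j}` runs over ordered pairs of indices; `f'`, `f''` are
`deriv f`, `deriv^[2] f`; the factor `‖f''‖_{L^∞((1-α)λ,(1+α)λ)}` is rendered by an arbitrary
bound `M` of `|f''|` on that open interval (the inequality is monotone in this factor, and for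
`f ∈ C²` the supremum is such a bound: `exists_simplex_expansion_bound_sSup` is the instance
`M = sup |f''|`). Witnesses: `C = 20`, `α₀ = ¼`.
[cite: Theil2006, §2.4 Lemma 2.10 (30) (preprint p. 10)] -/
theorem exists_simplex_expansion_bound :
    ∃ C α₀ : ℝ, 0 < C ∧ 0 < α₀ ∧ ∀ ⦃α : ℝ⦄, α ∈ Ioo 0 α₀ →
      ∀ ⦃f : ℝ → ℝ⦄, ContDiffOn ℝ 2 f (Ici 0) → ∀ ⦃lam : ℝ⦄, 0 < lam →
      ∀ y : Fin 3 → Plane, (∀ i j, i ≠ j → |dist (y i) (y j) / lam - 1| ≤ α) →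
      ∀ ⦃M : ℝ⦄, (∀ r ∈ Ioo ((1 - α) * lam) ((1 + α) * lam), |deriv^[2] f r| ≤ M) →
        |2 * √3 / lam * deriv f lam *
              ((volume (convexHull ℝ ({y 0, y 1, y 2} : Set Plane))).toReal - √3 / 4 * lam ^ 2)
            + 3 * f lam - 1 / 2 * ∑ i, ∑ j with j ≠ i, f (dist (y i) (y j))|
          ≤ C * (|deriv f lam| / lam + M) * ∑ i, ∑ j with j ≠ i, (dist (y i) (y j) - lam) ^ 2 :=
  ⟨20, 1 / 4, by norm_num, by norm_num, fun _ hα _ hf _ hlam y hy _ hM =>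
    simplex_expansion_bound_explicit hα hf hlam y hy hM⟩

/-- For `f ∈ C²([0, ∞))`, `f''` is continuous on `(0, ∞)`. [folklore] -/
private theorem continuousOn_deriv2_of_contDiffOn_Ici {f : ℝ → ℝ} (hf : ContDiffOn ℝ 2 f (Ici 0)) :
    ContinuousOn (deriv^[2] f) (Ioi 0) := by
  show ContinuousOn (deriv (deriv f)) (Ioi 0)
  have h1 : ContDiffOn ℝ 1 (deriv f) (Ioi 0) :=
    (hf.mono Ioi_subset_Ici_self).deriv_of_isOpen isOpen_Ioi (by norm_num)
  exact (h1.deriv_of_isOpen isOpen_Ioi (m := 0) (by norm_num)).continuousOn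

/-- **Theil 2006, Lemma 2.10** with the printed factor `‖f''‖_{L^∞((1-α)λ,(1+α)λ)}`, rendered as
the supremum `sup_{r ∈ ((1-α)λ,(1+α)λ)} |f''(r)|` (`= ess sup` for the continuous `f''`; it is
finite because `f''` is continuous on the compact closure, which lies in `(0, ∞)`).
[cite: Theil2006, §2.4 Lemma 2.10 (30) (preprint p. 10)] -/
theorem exists_simplex_expansion_bound_sSup :
    ∃ C α₀ : ℝ, 0 < C ∧ 0 < α₀ ∧ ∀ ⦃α : ℝ⦄, α ∈ Ioo 0 α₀ →
      ∀ ⦃f : ℝ → ℝ⦄, ContDiffOn ℝ 2 f (Ici 0) → ∀ ⦃lam : ℝ⦄, 0 < lam →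
      ∀ y : Fin 3 → Plane, (∀ i j, i ≠ j → |dist (y i) (y j) / lam - 1| ≤ α) →
        |2 * √3 / lam * deriv f lam *
              ((volume (convexHull ℝ ({y 0, y 1, y 2} : Set Plane))).toReal - √3 / 4 * lam ^ 2)
            + 3 * f lam - 1 / 2 * ∑ i, ∑ j with j ≠ i, f (dist (y i) (y j))|
          ≤ C * (|deriv f lam| / lam
              + sSup ((fun r => |deriv^[2] f r|) '' Ioo ((1 - α) * lam) ((1 + α) * lam)))
            * ∑ i, ∑ j with j ≠ i, (dist (y i) (y j) - lam) ^ 2 := by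
  refine ⟨20, 1 / 4, by norm_num, by norm_num, fun α hα f hf lam hlam y hy => ?_⟩
  refine simplex_expansion_bound_explicit hα hf hlam y hy fun r hr => ?_
  have hlo : (0 : ℝ) < (1 - α) * lam := mul_pos (by linarith [hα.2]) hlam
  have hcont : ContinuousOn (fun r => |deriv^[2] f r|) (Icc ((1 - α) * lam) ((1 + α) * lam)) :=
    ((continuousOn_deriv2_of_contDiffOn_Ici hf).mono fun t ht => hlo.trans_le ht.1).abs
  have hbdd : BddAbove ((fun r => |deriv^[2] f r|) '' Ioo ((1 - α) * lam) ((1 + α) * lam)) :=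
    (isCompact_Icc.bddAbove_image hcont).mono (image_mono Ioo_subset_Icc_self)
  exact le_csSup hbdd (mem_image_of_mem _ hr)

end Theil2006

end Literature.MathematicalPhysics.StatisticalMechanics
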